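import Literature.Barriers.QuantumFields.FiniteTemperatureDeconfinement
import HarnessLib

/-!
# Tomboulis–Yaffe 1985: non-confinement of `SU(2)` lattice gauge theory at high temperature in
# `d ≥ 2` space dimensions — the Polyakov-loop and the vortex (magnetic ∕ electric flux) free-energy
# theorems, as named facts

Topic `Literature/MathematicalPhysics/QuantumFieldTheory`; vocabulary of
`Literature.Barriers.QuantumFields.FiniteTemperature` (the finite-temperature Wilson theory on the
periodic lattice `ℤ_{L₀} × (ℤ/L)^d` with a time-like plaquette coupling `J_E` and a space-like one
`J_M`, its `expectation`, the Polyakov-loop two-point function `polyakovCorrelation`; Borgs–Seiler's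
lattice, which is Tomboulis–Yaffe's `L_t × L_s^d` lattice with `β_t = J_E`, `β_s = J_M`).

Source: E. T. Tomboulis, L. G. Yaffe, *Finite temperature SU(2) lattice gauge theory*, Commun. Math.
Phys. **100** (1985) 313–341 [TomboulisYaffe1985] (Project Euclid scan read in full this session; page
numbers below are the printed ones).  Its Appendix I (the reflection-positivity chain (A1.3)–(A1.9) =
(2.10) bounding Wilson loops and Polyakov-loop correlators by the electric-flux free energy) is
PROVED in the tree (`Literature.MathematicalPhysics.QuantumFieldTheory.TomboulisYaffe.wilsonLoop_abs_le_twist`,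
`….polyakovCorrelator_norm_le_twist`, `….neg_log_electricFlux_le_plaquette`, files
`TomboulisYaffeLoopBounds` ∕ `TomboulisYaffeTwistBound` ∕ `TomboulisYaffeInequality`).  This file
vendors the two theorems of its §III (both since DISCHARGED in the tree — see HONEST FRAMING below;
the displays are quoted from the page images of the scan, its text layer drops them):

* **Theorem I** (p. 320; proof §III.A–C pp. 321–325 with App. II–IV): "For every coupling `g² > 0`
  and spatial dimension `d ≥ 2` there is a temperature `T* < ∞` and a function `μ(T)` such that for
  all temperatures `T > T*` [sic: the page prints `T < T*` here, a misprint — the corollary sentence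
  on p. 321 and the proof have `T > T*`] and all sites `x, y ∈ Λ_s`,
  `F^{qq̄}_Λ(x, y)/T ≤ μ(T) < ∞`, with `μ(T)` bounded uniformly as the spatial lattice size
  `L_s → ∞`. Furthermore `μ(T) → 0` as `T → ∞`."  p. 321: "Using the definitions (2.6) and (2.7),
  Theorem I has the trivial corollary that for all `T > T*` the two point function of the twist
  [= Polyakov loop `Ω[x]`; (2.6), p. 316: `exp(−F^{qq̄}(x,x')/T) = ⟨½tr Ω[x] ½tr Ω[x']⟩_Λ ≡ G_Λ(x,x')`]
  is bounded from below, as is the magnetization".  VENDORED: `G_Λ(x,0) ≥ e^{−μ(T)}` uniformly in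
  `L_s` and `x` with `μ → 0` — by the definition (2.6) of `F^{qq̄}` this IS the displayed statement
  (the "corollary" and the theorem coincide).
* **Theorem II** (p. 320): "For every coupling `g² > 0` and dimension `d ≥ 2` there is a temperature
  `T** < ∞` and a function `ρ(T)` such that for all `T > T**`, `F^{elec}_Λ/T ≤ ρ(T) < ∞` uniformly
  in `L_s`."  p. 321: "Similarly, Theorem II is equivalent to the upper bound
  `exp(−F^{mag}/T) ≤ 1 − 2 exp(−ρ(T)) < 1` for all `T > T**`."  VENDORED: this printed equivalent
  form (with `ε = e^{−ρ(T)} > 0`; by (2.9) it is the displayed statement).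

The objects (§II.A, pp. 316–317): `(2.8)` "The magnetic flux free energy is defined by changing the
sign of the gauge coupling on a topologically non-trivial stack of plaquettes. Explicitly,
`exp(−F^{mag}_Λ/T) ≡ ⟨τ[S₀₁]⟩_Λ ≡ ⟨∏_{p ∈ S₀₁} exp −2β_t tr(U[∂p])⟩_Λ` where `S₀₁` is any coclosed set of
plaquettes which winds once through each [01] plane of the lattice. (For example,
`S₀₁ = {P₀₁(n) | n₀ = n₁ = 0}`.)"; `(2.9)` "The electric flux free energy is simply related to the
magnetic free energy, `exp(−F^{elec}_{01}/T) = ½(1 − exp(−F^{mag}_{01}/T)) = ⟨½(1 − τ[S₀₁])⟩`."  This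
is 't Hooft's maximal temporal twist ∕ the `SU(2)` vortex free energy of one periodic box (Tomboulis
2007 (6.1), (6.3): `exp(−F⁻) = Z⁻/Z`, `exp(−F^{el}) = ½(1 − Z⁻/Z)`; tree, symmetric torus:
`twistedPartitionFunction`, `Tomboulis2007.vortexRatio`).

The printed mechanism (cited, not formalised): hemisphere projections `P^±` (3.1) and the two
reflection-positivity reductions (3.2) [`G` from below by nearest-defect probabilities] and (3.3)
[`exp(−F^{mag}/T)` from above: the change of variables flipping the time-like links
`{l₀(n) | n₀ = n₁ = 0}` moves `S₀₁` to `S'₀₁ = {P₀₁(n) | n₀ = 0, n₁ = −1}`, then reflection positivity in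
the planes `⊥ e₁` through `0` and `x = ½L_s e₁`] (§III.A, pp. 321–322); the Peierls argument
(3.4)–(3.8) with the contour count of App. II (3.7); chessboard estimates (2.6)–(2.7) ⟹ (3.9)–(3.10);
the reduction of `L_t` time slices to ONE effective slice by the transfer-matrix bounds of App. III
— (3.13)–(3.15): `T^{L_t}` is bounded by a one-slice kernel with a "renormalized" coupling `β_>` =
the `k`-th iterate (`L_t = 2^k`) of the one-step map (3.14) built from the `SU(2)` one-link Bessel
integral `f(z)` of (A3.2), i.e. a reflection-positivity ∕ convexity-controlled Migdal-type
DECIMATION IN THE TIME DIRECTION, upper bound (A3.3)–(A3.5), lower bound (A3.6)–(A3.9) ("several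
renormalization group transformations which are simple enough to be rigorously controlled and are
sufficiently accurate to preserve the overall power of `T`", §I p. 314); the `d`-dimensional
XY-model comparison (3.16)–(3.22) (App. IV) and the disorder bounds (3.23)–(3.26).

PARAMETRISATION (faithfulness note). TY's action is (2.1)
`S_g = β_t Σ_{p_t} tr(U[∂p_t] − 1) + β_s Σ_{p_s} tr(U[∂p_s] − 1)` (full traces, as in the tree's
`FiniteTemperature.minusAction`) with couplings (2.2) `β_t = c_g (a_s/a_t) = c_g L_t a_s T`,
`β_s = c_g (a_t/a_s) = c_g (L_t a_s T)⁻¹`, `c_g = (2/g²) a_s^{d−3}` ("Note that increasing temperature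
corresponds to increasing timelike coupling (`β_t`) and decreasing spacelike coupling (`β_s`)",
p. 315; the prefactor `c_g` is immaterial below, `γ` ranging over all positive reals), temperature
`T = (L_t a_t)⁻¹`; so at fixed bare coupling `g²`,
temporal extent `L_t` and spatial spacing `a_s` the temperature sweep is the hyperbola
`(β_t, β_s) = (γθ, γ/θ)`, `γ = c_g > 0` fixed, `θ = a_s/a_t = L_t a_s T ∝ T`; "`T > T*`" is
"`θ > θ₀`".  The facts below are stated on this hyperbola with `θ₀` (and `μ`, `ε`) allowed to depend
on `γ`, `d` AND the temporal extent `L₀ = L_t` (TY let `T*` depend on "the bare coupling and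
dimension"; the constant `c` of (3.22) "depends on the bare coupling `g²` and `L_t`" — letting the
threshold depend on `L_t` is the weaker reading).  TY assume `L_t` and `L_s` are powers of two (§II
p. 314) and `L_s ≥ 4` (App. II p. 333); the normalisation `G_TY = ¼ · polyakovCorrelation` (`N = 2`,
real traces) and the identification `J_E = β_t`, `J_M = β_s` up to the immaterial additive constants
`tr(U − 1)` of (2.1) are used.  Theorem I is vendored through its printed corollary (the two-point
lower bound `G ≥ e^{−μ}` with `μ → 0`), at `y = 0` (translation invariance).  Nothing here is
claimed for `d = 1` ("in one space dimension static quarks are confined for all temperatures",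
footnote 2), for other groups (App. I's closing remark extends the INEQUALITIES of App. I to groups
with non-trivial centre, not Theorems I–II), for the zero-temperature theory, or for a continuum
limit.  Borgs–Seiler's theorem (tree: `Literature.Barriers.QuantumFields.FiniteTemperatureDeconfinement_holds`,
PROVED) gives Polyakov long-range order for `U(N)`, `SU(N)` in `d ≥ 3` uniformly in `J_M`; Theorem I
is the only printed deconfinement result covering `SU(2)` in `d = 2` space dimensions (infrared
bounds need `d ≥ 3`), and Theorem II concerns a different order parameter (the vortex ∕ electric-flux
free energy).

HONEST FRAMING.  Two NAMED FACTS (`def … : Prop`, not proved IN THIS FILE: the printed proof is a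
Peierls argument with rigorously controlled time-decimation bounds, App. II–IV) and small PROVED API:
the flux observables, the `Z⁻/Z` form, positivity, and the corollaries
`MagneticFluxFreeEnergyBound.electricFlux_pos`,
`PolyakovTwoPointLowerBound.not_uniformClusteringAtAllCouplings` ∕ `.not_temperatureBlindUniformClustering`
(temperature-blind volume-uniform clustering of Polyakov loops — the output shape of strong-coupling
expansions — fails for `SU(2)` already in `2+1` dimensions, modulo the fact).  BOTH FACTS ARE
DISCHARGED downstream (this file is imported by the proof files, so the `_holds` theorems cannot live
here): `TomboulisYaffeHighTemperature.PolyakovTwoPointLowerBound_holds` and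
`….MagneticFluxFreeEnergyBound_holds` in `SU2HighTemperatureNonConfinementHolds`, via the Peierls
reduction `SU2HighTemperaturePeierlsReduction` (§III.A–B, App. II), the chessboard ∕ reflection-
positivity step `FiniteTemperaturePolyakovChessboard` ((2.6)–(2.7) ⟹ (3.9)–(3.10); (3.25)–(3.26) from
full-lattice pattern bounds; removal of `J_M`), the temporal gauge ∕ transfer kernel
`FiniteTemperatureTemporalGauge` ((3.11)–(3.12)), the `SU(2)` kernel bounds `SU2PolyakovPairKernel` ∕
`SU2TwoLinkConvolution` ∕ `SU2TransferKernelBound` ((3.13)–(3.17), App. III) and the pattern bounds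
`SU2ElectricPatternBounds` ((3.18)–(3.24) at `J_M = 0`); the same `…Holds` file carries the
hypothesis-free forms `…_su2_holds` of all corollaries of §§3–4 below.
The Yang–Mills mass gap is not touched; these are finite-temperature LATTICE statements.

## References
* E. T. Tomboulis, L. G. Yaffe, Commun. Math. Phys. 100 (1985) 313–341, §II (2.1)–(2.10), §III
  Theorems I–II, (3.1)–(3.26), App. I–IV. [TomboulisYaffe1985]
* C. Borgs, E. Seiler, Commun. Math. Phys. 91 (1983) 329–380 ("previously demonstrated for any
  SU(N) gauge group in three or more dimensions", TY p. 314). [BorgsSeiler1983]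
* E. T. Tomboulis, arXiv:0707.2179, §6.1 (6.1)–(6.4). [Tomboulis2007Confinement]
-/

noncomputable section

open MeasureTheory Filter Finset
open scoped Topology BigOperators ComplexConjugate
open Literature.MathematicalPhysics.QuantumLattice (fundamentalRep continuous_fundamentalRep
  fundamentalRep_mem_unitaryGroup)
open Literature.Barriers.QuantumFields

namespace Literature.MathematicalPhysics.QuantumFieldTheory

namespace TomboulisYaffeHighTemperature

variable {d L₀ L : ℕ} {G : Type*} [Group G] {N : ℕ} (ρ : G →* Matrix (Fin N) (Fin N) ℂ)

/-! ### §1 The magnetic- and electric-flux free energies (2.8)–(2.9) on Borgs–Seiler's lattice -/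

variable (d L₀ L) in
/-- The coclosed stack `S_{0i} = {P_{0i}(n) | n₀ = n_i = 0}` of time-like plaquettes in the
`(time, i)` planes, listed by base points: the sites with time coordinate `0` and `i`-th spatial
coordinate `0` (one plaquette per transverse position; it "winds once through each [0i] plane of
the lattice"). [cite: TomboulisYaffe1985, §II.A eq. (2.8) (p. 317)] -/
def fluxStack [NeZero L₀] [NeZero L] (i : Fin d) : Finset (FiniteTemperature.Site d L₀ L) :=
  univ.filter fun x => x.1 = 0 ∧ x.2 i = 0

/-- **The magnetic-flux (vortex) observable of (2.8)**: `∏_{p ∈ S_{0i}} exp(−2 J_E Re tr ρ(U[∂p]))`,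
i.e. the factor which changes the sign of the time-like coupling `J_E` on the stack `S_{0i}`.
[cite: TomboulisYaffe1985, §II.A eq. (2.8) (p. 317)] -/
def magneticFluxObs [NeZero L₀] [NeZero L] (JE : ℝ) (i : Fin d)
    (U : FiniteTemperature.Config d L₀ L G) : ℝ :=
  ∏ x ∈ fluxStack d L₀ L i,
    Real.exp (-(2 * JE * (ρ (FiniteTemperature.plaquette U x none (some i))).trace.re))

/-- Minus the action with the sign of `J_E` changed on the stack `S_{0i}` ("changing the sign of the
gauge coupling on a topologically non-trivial stack of plaquettes"). [cite: TomboulisYaffe1985, §II.A eq. (2.8) (p. 317)] -/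
def twistedMinusAction [NeZero L₀] [NeZero L] (JE JM : ℝ) (i : Fin d)
    (U : FiniteTemperature.Config d L₀ L G) : ℝ :=
  FiniteTemperature.minusAction ρ JE JM U -
    2 * JE * ∑ x ∈ fluxStack d L₀ L i, (ρ (FiniteTemperature.plaquette U x none (some i))).trace.re

/-- The flux observable (2.8) is positive (a product of exponentials). [cite: TomboulisYaffe1985, §II.A eq. (2.8) (p. 317)] -/
theorem magneticFluxObs_pos [NeZero L₀] [NeZero L] (JE : ℝ) (i : Fin d)
    (U : FiniteTemperature.Config d L₀ L G) : 0 < magneticFluxObs ρ JE i U :=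
  prod_pos fun _ _ => Real.exp_pos _

/-- `(flux factor) · e^{−S} = e^{−S_twisted}`: inserting the observable (2.8) IS flipping the sign of
the coupling on the stack. [cite: TomboulisYaffe1985, §II.A eq. (2.8) (p. 317)] -/
theorem magneticFluxObs_mul_weight [NeZero L₀] [NeZero L] (JE JM : ℝ) (i : Fin d)
    (U : FiniteTemperature.Config d L₀ L G) :
    magneticFluxObs ρ JE i U * FiniteTemperature.weight ρ JE JM U =
      Real.exp (twistedMinusAction ρ JE JM i U) := by
  unfold magneticFluxObs FiniteTemperature.weight twistedMinusAction
  rw [← Real.exp_sum, ← Real.exp_add]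
  congr 1
  rw [mul_sum, sum_neg_distrib]
  ring

variable [TopologicalSpace G] [IsTopologicalGroup G] [CompactSpace G] [MeasurableSpace G]
  [BorelSpace G]

/-- **`exp(−F^{mag}_{0i}/T)`** (2.8): the expectation of the coupling-flipping factor on the stack
`S_{0i}` in the periodic box `ℤ_{L₀} × (ℤ/L)^d` at couplings `(J_E, J_M)`.
[cite: TomboulisYaffe1985, §II.A eq. (2.8) (p. 317)] -/
def magneticFluxExp [NeZero L₀] [NeZero L] (JE JM : ℝ) (i : Fin d) : ℝ :=
  FiniteTemperature.expectation (d := d) (L₀ := L₀) (L := L) ρ JE JM (magneticFluxObs ρ JE i)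

/-- **`exp(−F^{elec}_{0i}/T) = ½(1 − exp(−F^{mag}_{0i}/T))`** (2.9) (the `ℤ₂` Fourier transform over
the centre of `SU(2)`; for `SU(2)` this file's only use). [cite: TomboulisYaffe1985, §II.A eq. (2.9) (p. 317)] -/
def electricFluxExp [NeZero L₀] [NeZero L] (JE JM : ℝ) (i : Fin d) : ℝ :=
  (1 - magneticFluxExp (d := d) (L₀ := L₀) (L := L) ρ JE JM i) / 2

/-- **`exp(−F^{mag}/T) = Z⁻/Z`**: the magnetic-flux expectation is the ratio of the partition
function with the coupling flipped on the stack to the untwisted one (Tomboulis 2007 (6.1)).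
[cite: TomboulisYaffe1985, §II.A eq. (2.8) (p. 317)] [cite: Tomboulis2007Confinement, §6.1 eq. (6.1)] -/
theorem magneticFluxExp_eq_ratio [NeZero L₀] [NeZero L] (JE JM : ℝ) (i : Fin d) :
    magneticFluxExp (d := d) (L₀ := L₀) (L := L) ρ JE JM i =
      (∫ U, Real.exp (twistedMinusAction ρ JE JM i U) ∂FiniteTemperature.haar d L₀ L G) /
        (∫ U, FiniteTemperature.weight ρ JE JM U ∂FiniteTemperature.haar d L₀ L G) := by
  unfold magneticFluxExp FiniteTemperature.expectation
  simp_rw [magneticFluxObs_mul_weight]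

omit [CompactSpace G] [MeasurableSpace G] [BorelSpace G] in
/-- The twisted action is continuous for a continuous representation. [folklore] -/
private theorem continuous_twistedMinusAction [NeZero L₀] [NeZero L] (hρ : Continuous ρ) (JE JM : ℝ)
    (i : Fin d) :
    Continuous fun U : FiniteTemperature.Config d L₀ L G => twistedMinusAction ρ JE JM i U := by
  unfold twistedMinusAction
  refine (FiniteTemperature.continuous_minusAction ρ hρ JE JM).sub (continuous_const.mul ?_)
  exact continuous_finsetSum _ fun x _ =>
    Complex.continuous_re.comp
      (Continuous.matrix_trace (hρ.comp (FiniteTemperature.continuous_plaquette x _ _)))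

variable [SecondCountableTopology G]

/-- **`exp(−F^{mag}/T) > 0`** (a ratio of integrals of positive continuous functions).
[cite: TomboulisYaffe1985, §II.A eq. (2.8) (p. 317)] -/
theorem magneticFluxExp_pos [NeZero L₀] [NeZero L] (hρ : Continuous ρ) (JE JM : ℝ) (i : Fin d) :
    0 < magneticFluxExp (d := d) (L₀ := L₀) (L := L) ρ JE JM i := by
  rw [magneticFluxExp_eq_ratio]
  refine div_pos ?_ (FiniteTemperature.partitionFunction_pos ρ hρ JE JM)
  exact integral_exp_pos (FiniteTemperature.integrable_of_continuous
    (Real.continuous_exp.comp (continuous_twistedMinusAction ρ hρ JE JM i)))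

/-- Hence `exp(−F^{elec}/T) < ½`. [cite: TomboulisYaffe1985, §II.A eq. (2.9) (p. 317)] -/
theorem electricFluxExp_lt_half [NeZero L₀] [NeZero L] (hρ : Continuous ρ) (JE JM : ℝ)
    (i : Fin d) : electricFluxExp (d := d) (L₀ := L₀) (L := L) ρ JE JM i < 1 / 2 := by
  unfold electricFluxExp
  have := magneticFluxExp_pos (d := d) (L₀ := L₀) (L := L) ρ hρ JE JM i
  linarith

end TomboulisYaffeHighTemperature

/-! ### §2 The two theorems of §III as named facts (`SU(2)`, fundamental representation) -/

namespace TomboulisYaffeHighTemperature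

/-- **Tomboulis–Yaffe 1985, Theorem I (non-confinement of static quarks at high temperature, `SU(2)`,
`d ≥ 2` space dimensions): `F^{qq̄}_Λ(x,y)/T ≤ μ(T)`, i.e. by (2.6) "the two point function of the
twist is bounded from below", with a bound tending to its maximum.**  For every `γ > 0` (`∝ 1/g²`),
every `d ≥ 2` and every temporal extent `L₀ = 2^a` there are `θ₀` and a function `μ` with `μ(θ) → 0`
as `θ → ∞` such that for all `θ > θ₀` (temperature above `T*`, along TY's fixed-coupling hyperbola
`(J_E, J_M) = (γθ, γ/θ)`), all spatial sides `L = 2^k ≥ 4` and all `x`: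
`¼ · G_L(x) = ⟨½tr Ω[0] ½tr Ω[x]⟩ = exp(−F^{qq̄}_Λ(0,x)/T) ≥ e^{−μ(θ)}` — uniformly in `L`.  Printed:
"For every coupling `g² > 0` and spatial dimension `d ≥ 2` there is a temperature `T* < ∞` and a
function `μ(T)` such that for all temperatures `T > T*` and all sites `x, y ∈ Λ_s`,
`F^{qq̄}_Λ(x, y)/T ≤ μ(T) < ∞`, with `μ(T)` bounded uniformly as the spatial lattice size `L_s → ∞`.
Furthermore `μ(T) → 0` as `T → ∞`." and "for all `T > T*` the two point function of the twist is
bounded from below, as is the magnetization" (pp. 320–321); proof §III.A–C (3.1)–(3.26), App. II–IV.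
See the module docstring for the parametrisation and for what is not covered.  DISCHARGED:
`PolyakovTwoPointLowerBound_holds` (file `SU2HighTemperatureNonConfinementHolds`).
[cite: TomboulisYaffe1985, §III Theorem I (p. 320) and its corollary (p. 321); (2.6) (p. 316); (3.2), (3.8), (3.25)] -/
def PolyakovTwoPointLowerBound : Prop :=
  ∀ γ : ℝ, 0 < γ → ∀ d : ℕ, 2 ≤ d → ∀ a : ℕ,
    ∃ θ₀ : ℝ, ∃ μ : ℝ → ℝ, Tendsto μ atTop (𝓝 0) ∧
      ∀ θ : ℝ, θ₀ < θ → ∀ k : ℕ, 2 ≤ k → ∀ x : Fin d → ZMod (2 ^ k),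
        4 * Real.exp (-μ θ) ≤
          FiniteTemperature.polyakovCorrelation (d := d) (L₀ := 2 ^ a) (L := 2 ^ k)
            (fundamentalRep (Fin 2)) (γ * θ) (γ / θ) x

/-- **Tomboulis–Yaffe 1985, Theorem II (the vortex ∕ electric-flux free energy at high temperature,
`SU(2)`, `d ≥ 2`), in the printed equivalent form `exp(−F^{mag}/T) ≤ 1 − 2 exp(−ρ(T)) < 1`
uniformly in `L_s`.**  For every `γ > 0`, `d ≥ 2` and `L₀ = 2^a` there is `θ₀` such that for every
`θ > θ₀` there is `ε > 0` (`= e^{−ρ(T)}`) with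
`exp(−F^{mag}_{01}/T) = ⟨∏_{p∈S₀₁} e^{−2J_E Re tr U[∂p]}⟩_{(γθ, γ/θ)} ≤ 1 − 2ε` for ALL spatial
sides `L = 2^k ≥ 4` — equivalently `exp(−F^{elec}/T) ≥ ε`
(`MagneticFluxFreeEnergyBound.electricFlux_pos`): the electric flux free energy stays bounded
as `L_s → ∞`, "interpreted as the absence of (linear) confinement" (p. 317).  Printed: "For every
coupling `g² > 0` and dimension `d ≥ 2` there is a temperature `T** < ∞` and a function `ρ(T)`
such that for all `T > T**`, `F^{elec}_Λ/T ≤ ρ(T) < ∞` uniformly in `L_s`." and "Theorem II is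
equivalent to the upper bound `exp(−F^{mag}/T) ≤ 1 − 2exp(−ρ(T)) < 1` for all `T > T**`"
(pp. 320–321; (2.9): `exp(−F^{elec}_Λ/T) ≡ ½(1 − exp(−F^{mag}_Λ/T))`); proof via (3.3) and the
Peierls ∕ transfer-matrix bounds (3.4)–(3.26), App. III.  The stack is taken in the
`(time, first spatial axis)` planes as printed (`S₀₁`).  DISCHARGED: `MagneticFluxFreeEnergyBound_holds`
(file `SU2HighTemperatureNonConfinementHolds`).
[cite: TomboulisYaffe1985, §III Theorem II (p. 320) and the sentence after it (p. 321); (2.9) (p. 317); (3.3), (3.8), (3.26)] -/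
def MagneticFluxFreeEnergyBound : Prop :=
  ∀ γ : ℝ, 0 < γ → ∀ d : ℕ, (hd : 2 ≤ d) → ∀ a : ℕ,
    ∃ θ₀ : ℝ, ∀ θ : ℝ, θ₀ < θ → ∃ ε : ℝ, 0 < ε ∧ ∀ k : ℕ, 2 ≤ k →
      magneticFluxExp (d := d) (L₀ := 2 ^ a) (L := 2 ^ k) (fundamentalRep (Fin 2))
        (γ * θ) (γ / θ) ⟨0, by omega⟩ ≤ 1 - 2 * ε

/-! ### §3 Proved corollaries -/

/-- **Theorem II ⟹ the electric-flux free energy is bounded at high temperature**: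
`exp(−F^{elec}/T) ≥ ε(T) > 0` uniformly in `L_s` ((2.9) applied to the fact).
[cite: TomboulisYaffe1985, §III Theorem II (p. 320); §II.A eq. (2.9) (p. 317)] -/
theorem MagneticFluxFreeEnergyBound.electricFlux_pos (h : MagneticFluxFreeEnergyBound) {γ : ℝ}
    (hγ : 0 < γ) {d : ℕ} (hd : 2 ≤ d) (a : ℕ) :
    ∃ θ₀ : ℝ, ∀ θ : ℝ, θ₀ < θ → ∃ ε : ℝ, 0 < ε ∧ ∀ k : ℕ, 2 ≤ k →
      ε ≤ electricFluxExp (d := d) (L₀ := 2 ^ a) (L := 2 ^ k) (fundamentalRep (Fin 2))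
        (γ * θ) (γ / θ) ⟨0, by omega⟩ := by
  obtain ⟨θ₀, hθ⟩ := h γ hγ d hd a
  refine ⟨θ₀, fun θ hθθ => ?_⟩
  obtain ⟨ε, hε, hk⟩ := hθ θ hθθ
  refine ⟨ε, hε, fun k hk2 => ?_⟩
  have := hk k hk2
  unfold electricFluxExp
  linarith

/-- Transport of the Polyakov correlation along an equality of spatial sides. [folklore] -/
private theorem polyakovCorrelation_congr_side {d : ℕ} {G : Type*} [Group G] [TopologicalSpace G]
    [IsTopologicalGroup G] [CompactSpace G] [MeasurableSpace G] [BorelSpace G] {N : ℕ}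
    (ρ : G →* Matrix (Fin N) (Fin N) ℂ) {L₀ : ℕ} [NeZero L₀] {L L' : ℕ} [NeZero L] [NeZero L']
    (hL : L = L') (JE JM : ℝ) (x : Fin d → ℤ) :
    FiniteTemperature.polyakovCorrelation (d := d) (L₀ := L₀) (L := L) ρ JE JM
        (fun i => ((x i : ℤ) : ZMod L)) =
      FiniteTemperature.polyakovCorrelation (d := d) (L₀ := L₀) (L := L') ρ JE JM
        (fun i => ((x i : ℤ) : ZMod L')) := by
  subst hL
  rfl

/-- **Theorem I ⟹ no volume-uniform exponential clustering of Polyakov loops at all couplings, for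
`SU(2)` in every `d ≥ 2` at every temporal extent `L₀ = 2^a`** — the technique class (ii)
`FiniteTemperature.UniformClusteringAtAllCouplings` of the barrier
`Literature.Barriers.QuantumFields.FiniteTemperatureDeconfinement` (the output shape of convergent
strong-coupling expansions) is refuted in `2+1` dimensions as well (the tree's unconditional
refutations `not_uniformClusteringAtAllCouplings_specialUnitary_holds` need `d ≥ 3`).  Proof: at
`(J_E, J_M) = (γθ, γ/θ)` with `θ` large a uniform bound `|G_L(x)| ≤ C e^{−m‖x‖}` on the even boxes
`L = 2^{j+2} = 2(2^{j+1} − 1) + 2` contradicts `G_L(2^{j+1} e_0) ≥ 4e^{−μ(θ)}` for large `j`.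
[cite: TomboulisYaffe1985, §III Theorem I (p. 320)] -/
theorem PolyakovTwoPointLowerBound.not_uniformClusteringAtAllCouplings
    (h : PolyakovTwoPointLowerBound) {γ : ℝ} (hγ : 0 < γ) {d : ℕ} (hd : 2 ≤ d) (a : ℕ) :
    ¬ FiniteTemperature.UniformClusteringAtAllCouplings d (2 ^ a) (fundamentalRep (Fin 2)) := by
  intro hU
  obtain ⟨θ₀, μ, -, hθ⟩ := h γ hγ d hd a
  -- a temperature above threshold with positive couplings
  set θ : ℝ := max θ₀ 0 + 1 with hθdef
  have hθ₀ : θ₀ < θ := by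
    have := le_max_left θ₀ 0; rw [hθdef]; linarith
  have hθpos : 0 < θ := by
    have := le_max_right θ₀ 0; rw [hθdef]; linarith
  obtain ⟨C, m, hm, hb⟩ := hU (γ * θ) (γ / θ) (mul_pos hγ hθpos) (div_pos hγ hθpos)
  have hd0 : 0 < d := by omega
  -- the lower bound `4 e^{-μ θ}` versus `C e^{-m 2^{j+1}}` along the boxes `L = 2^{j+2}`
  have key : ∀ j : ℕ, 4 * Real.exp (-μ θ) ≤ C * Real.exp (-(m * (2 : ℝ) ^ (j + 1))) := by
    intro j
    -- the box `L = 2^{j+2}` written as `2 k + 2` with `k = 2^{j+1} - 1`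
    obtain ⟨k, hk⟩ : ∃ k : ℕ, k + 1 = 2 ^ (j + 1) :=
      ⟨2 ^ (j + 1) - 1, Nat.sub_add_cancel Nat.one_le_two_pow⟩
    have hkL : 2 * k + 2 = 2 ^ (j + 2) := by
      rw [pow_succ, ← hk]; ring
    have hk1 : (k : ℤ) + 1 = 2 ^ (j + 1) := by exact_mod_cast hk
    -- the test site `x = 2^{j+1} e_0`, in the fundamental domain `|x_i| ≤ k + 1`
    set x : Fin d → ℤ := Pi.single (⟨0, hd0⟩ : Fin d) ((2 : ℤ) ^ (j + 1)) with hxdef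
    have hxdom : ∀ i, |x i| ≤ (k : ℤ) + 1 := by
      intro i
      rw [hk1, hxdef]
      by_cases hi : i = ⟨0, hd0⟩
      · subst hi
        rw [Pi.single_eq_same, abs_of_nonneg (by positivity)]
      · rw [Pi.single_eq_of_ne hi, abs_zero]
        positivity
    have hxnorm : ‖x‖ = (2 : ℝ) ^ (j + 1) := by
      rw [hxdef, Pi.norm_single, Int.norm_eq_abs, abs_of_nonneg (by positivity)]
      push_cast
      ring
    have hup := hb k x hxdom
    rw [hxnorm, neg_mul] at hup
    -- Theorem I's lower bound on the same box, transported along `2k+2 = 2^{j+2}`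
    have hlow := hθ θ hθ₀ (j + 2) (by omega) (fun i => ((x i : ℤ) : ZMod (2 ^ (j + 2))))
    rw [← polyakovCorrelation_congr_side (fundamentalRep (Fin 2)) hkL] at hlow
    exact hlow.trans ((le_abs_self _).trans hup)
  -- contradiction as `j → ∞`
  have h2 : Tendsto (fun j : ℕ => m * (2 : ℝ) ^ (j + 1)) atTop atTop :=
    ((tendsto_pow_atTop_atTop_of_one_lt one_lt_two).comp (tendsto_add_atTop_nat 1)).const_mul_atTop
      hm
  have hlim : Tendsto (fun j : ℕ => C * Real.exp (-(m * (2 : ℝ) ^ (j + 1)))) atTop (𝓝 (C * 0)) :=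
    tendsto_const_nhds.mul (Real.tendsto_exp_atBot.comp (tendsto_neg_atTop_atBot.comp h2))
  rw [mul_zero] at hlim
  have hpos : 0 < 4 * Real.exp (-μ θ) := by positivity
  obtain ⟨j, hj⟩ := (hlim.eventually (gt_mem_nhds hpos)).exists
  exact absurd (key j) (not_le.2 hj)

/-- Consequently the temperature-blind class (ii) fails for `SU(2)` in every `d ≥ 2` (take
`L₀ = 1 = 2⁰`). [cite: TomboulisYaffe1985, §III Theorem I (p. 320)] -/
theorem PolyakovTwoPointLowerBound.not_temperatureBlindUniformClustering
    (h : PolyakovTwoPointLowerBound) {d : ℕ} (hd : 2 ≤ d) :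
    ¬ FiniteTemperature.TemperatureBlindUniformClustering d (fundamentalRep (Fin 2)) := fun hT =>
  h.not_uniformClusteringAtAllCouplings one_pos hd 0 (by simpa using hT 1)

end TomboulisYaffeHighTemperature

/-! ### §4 (append) Long-range order along the power-of-two boxes: Polyakov's criterion fails for
`SU(2)` in every `d ≥ 2` at high temperature (modulo Theorem I)

Theorem I controls the boxes `L_s = 2^k` only, so it does not give the barrier's
`HasPolyakovLongRangeOrder` (which quantifies over limits along ALL even boxes); but it produces
ONE subsequential thermodynamic limit (along `L = 2^{j+2} = 2(2^{j+1} − 1) + 2`, by compactness)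
bounded below by `4e^{−μ(T)} > 0` everywhere — so the technique class (i)
`FiniteTemperature.PolyakovConfinementAtAllCouplings` (every thermodynamic limit of the Polyakov
correlation decays, at all couplings) and its temperature-blind form fail for `SU(2)` at every
temporal extent `L₀ = 2^a` in EVERY `d ≥ 2`.  Contrast (tree, PROVED): for `U(1)` class (i)
HOLDS in `d = 2` (`u1_temperatureBlindPolyakovConfinement_iff : … ↔ d = 2`, McBryan–Spencer) —
at finite temperature in `2+1` dimensions the abelian and the non-abelian theory differ, as the
centre (`U(1)` continuous vs `ℤ₂` discrete) predicts. -/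

namespace TomboulisYaffeHighTemperature

/-- `ℤ^d` is infinite for `d ≥ 1`, so its cofinite filter is non-trivial. [folklore] -/
private theorem cofinite_neBot_pi {d : ℕ} (hd : 0 < d) : (cofinite : Filter (Fin d → ℤ)).NeBot := by
  haveI : Infinite (Fin d → ℤ) :=
    Infinite.of_injective (fun n : ℤ => fun _ : Fin d => n) fun a b hab => congr_fun hab ⟨0, hd⟩
  infer_instance

/-- **Theorem I ⟹ a non-decaying thermodynamic limit of the Polyakov correlation** (`SU(2)`,
`d ≥ 2`, `L₀ = 2^a`, couplings `(γθ, γ/θ)` with `θ > θ₀`): along a subsequence of the boxes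
`L = 2^{j+2}` the two-point function converges pointwise on `ℤ^d` to a limit `G∞ ≥ 4e^{−μ(θ)}`;
in particular `G∞ ↛ 0`. [cite: TomboulisYaffe1985, §III Theorem I (p. 320) and its corollary (p. 321)] -/
theorem PolyakovTwoPointLowerBound.exists_isThermodynamicLimit_ge (h : PolyakovTwoPointLowerBound)
    {γ : ℝ} (hγ : 0 < γ) {d : ℕ} (hd : 2 ≤ d) (a : ℕ) :
    ∃ θ₀ : ℝ, ∃ μ : ℝ → ℝ, Tendsto μ atTop (𝓝 0) ∧ ∀ θ : ℝ, θ₀ < θ →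
      ∃ Ginf : (Fin d → ℤ) → ℝ,
        FiniteTemperature.IsThermodynamicLimit (d := d) (L₀ := 2 ^ a) (fundamentalRep (Fin 2))
          (γ * θ) (γ / θ) Ginf ∧ ∀ x, 4 * Real.exp (-μ θ) ≤ Ginf x := by
  obtain ⟨θ₀, μ, hμ, hθ⟩ := h γ hγ d hd a
  refine ⟨θ₀, μ, hμ, fun θ hθθ => ?_⟩
  -- the boxes `L_j = 2 (2^{j+1} - 1) + 2 = 2^{j+2}`
  set side : ℕ → ℕ := fun j => 2 ^ (j + 1) - 1 with hside
  have hsideL : ∀ j, 2 * side j + 2 = 2 ^ (j + 2) := by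
    intro j
    have hk : side j + 1 = 2 ^ (j + 1) := Nat.sub_add_cancel Nat.one_le_two_pow
    rw [pow_succ, ← hk]; ring
  have hside_mono : StrictMono side := by
    intro i j hij
    simp only [hside]
    have h1 : 2 ^ (i + 1) < 2 ^ (j + 1) := Nat.pow_lt_pow_right (by norm_num) (by omega)
    have := @Nat.one_le_two_pow (i + 1)
    omega
  -- the sequence of two-point functions on these boxes, as functions on `ℤ^d`
  set u : ℕ → (Fin d → ℤ) → ℝ := fun j x =>
    FiniteTemperature.polyakovCorrelation (d := d) (L₀ := 2 ^ a) (L := 2 * side j + 2)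
      (fundamentalRep (Fin 2)) (γ * θ) (γ / θ) (fun i => ((x i : ℤ) : ZMod (2 * side j + 2)))
    with hu
  -- uniform bounds: `4 e^{-μ θ} ≤ u j x ≤ 4`
  have hlow : ∀ j x, 4 * Real.exp (-μ θ) ≤ u j x := by
    intro j x
    have := hθ θ hθθ (j + 2) (by omega) (fun i => ((x i : ℤ) : ZMod (2 ^ (j + 2))))
    rwa [← polyakovCorrelation_congr_side (fundamentalRep (Fin 2)) (hsideL j)] at this
  have hup : ∀ j x, |u j x| ≤ (2 : ℝ) ^ 2 := fun j x =>
    FiniteTemperature.abs_polyakovCorrelation_le (fundamentalRep (Fin 2))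
      (continuous_fundamentalRep (Fin 2)) fundamentalRep_mem_unitaryGroup _ _ _
  -- compactness of `[-4, 4]^{ℤ^d}`: a pointwise convergent subsequence
  set S : Set ((Fin d → ℤ) → ℝ) := Set.pi Set.univ fun _ => Set.Icc (-(2 : ℝ) ^ 2) ((2 : ℝ) ^ 2)
  have hS : IsCompact S := isCompact_univ_pi fun _ => isCompact_Icc
  have hmem : ∀ j, u j ∈ S := fun j => by
    simp only [S, Set.mem_pi, Set.mem_univ, true_implies, Set.mem_Icc]
    exact fun x => abs_le.1 (hup j x)
  obtain ⟨Ginf, -, φ, hφ, hlim⟩ := hS.tendsto_subseq hmem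
  refine ⟨Ginf, ⟨fun k => side (φ k), hside_mono.comp hφ, fun x => ?_⟩, fun x => ?_⟩
  · have := tendsto_pi_nhds.1 hlim x
    simpa [hu, Function.comp_def] using this
  · exact ge_of_tendsto (tendsto_pi_nhds.1 hlim x) (Eventually.of_forall fun k => hlow (φ k) x)

/-- **Theorem I ⟹ Polyakov's confinement criterion fails at high temperature for `SU(2)` in every
`d ≥ 2` at every temporal extent `L₀ = 2^a`**: the technique class (i)
`FiniteTemperature.PolyakovConfinementAtAllCouplings d (2^a) (fundamentalRep (Fin 2))` of the
barrier `Literature.Barriers.QuantumFields.FiniteTemperatureDeconfinement` is refuted (the tree's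
unconditional refutation `not_polyakovConfinementAtAllCouplings_specialUnitary_holds` needs
`d ≥ 3`; for `U(1)` the class HOLDS in `d = 2`). [cite: TomboulisYaffe1985, §III Theorem I (p. 320); §I result A (p. 313)] -/
theorem PolyakovTwoPointLowerBound.not_polyakovConfinementAtAllCouplings
    (h : PolyakovTwoPointLowerBound) {γ : ℝ} (hγ : 0 < γ) {d : ℕ} (hd : 2 ≤ d) (a : ℕ) :
    ¬ FiniteTemperature.PolyakovConfinementAtAllCouplings d (2 ^ a) (fundamentalRep (Fin 2)) := by
  intro hP
  obtain ⟨θ₀, μ, -, hθ⟩ := h.exists_isThermodynamicLimit_ge hγ hd a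
  set θ : ℝ := max θ₀ 0 + 1 with hθdef
  have hθ₀ : θ₀ < θ := by
    have := le_max_left θ₀ 0; rw [hθdef]; linarith
  have hθpos : 0 < θ := by
    have := le_max_right θ₀ 0; rw [hθdef]; linarith
  obtain ⟨Ginf, hG, hGlow⟩ := hθ θ hθ₀
  have hdecay := hP (γ * θ) (γ / θ) (mul_pos hγ hθpos) (div_pos hγ hθpos) Ginf hG
  have hpos : 0 < 4 * Real.exp (-μ θ) := by positivity
  haveI := cofinite_neBot_pi (d := d) (by omega)
  obtain ⟨x, hx⟩ := (hdecay.eventually (gt_mem_nhds hpos)).exists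
  exact absurd (hGlow x) (not_le.2 hx)

/-- … hence the temperature-blind class (i) `FiniteTemperature.TemperatureBlindPolyakovConfinement`
fails for `SU(2)` in every `d ≥ 2` (take `L₀ = 1 = 2⁰`): for `SU(2)` lattice gauge theory in
`2+1` (and more) dimensions no confinement argument insensitive to the temporal extent can give
Polyakov-loop decay at all couplings — in `d = 2` a genuinely non-abelian phenomenon (for `U(1)`
the class holds there). [cite: TomboulisYaffe1985, §III Theorem I (p. 320); §I result A (p. 313)] -/
theorem PolyakovTwoPointLowerBound.not_temperatureBlindPolyakovConfinement
    (h : PolyakovTwoPointLowerBound) {d : ℕ} (hd : 2 ≤ d) :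
    ¬ FiniteTemperature.TemperatureBlindPolyakovConfinement d (fundamentalRep (Fin 2)) := fun hT =>
  h.not_polyakovConfinementAtAllCouplings one_pos hd 0 (by simpa using hT 1)

end TomboulisYaffeHighTemperature

end Literature.MathematicalPhysics.QuantumFieldTheory
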